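import Literature.NumberTheory.Automorphic.UnitaryGroupDualPairCarriers
import Literature.NumberTheory.Automorphic.UnitaryGroupDirectSum
import Literature.NumberTheory.Automorphic.UnitaryGroupRestrictedProduct
import HarnessLib

/-!
# The dual pair `U(J_V) × U(J_W) → U(J_V ⊗ J_W)` read in a `Fin n` enumeration, over any ring and over `𝔸_E^∞`, `𝔸_E`

Topic `NumberTheory/Automorphic`; namespace `Literature.NumberTheory.Automorphic.UnitaryGroup`.  KERNEL ONLY:
definitions with bodies and theorems; no record, no named fact, no `sorry`.

[GelbartRogawski1991, §3.1 p. 454; §3.2 p. 457] puts the unitary dual pair `U(V) × U(W)` inside the big unitary group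
`G₁ = U(V ⊗ W)` («`a : g ↦ g ⊗ 1`, `b : g' ↦ 1 ⊗ g'`»); the tree's carriers index `V ⊗ W` by `Fin N × Fin M`
(`UnitaryGroup.dualPair`, `adelicPair`, `adelicInl/adelicInr`) while its place-by-place machinery (local factors
`localPi`, `finAdelicEquiv`, local splittings `FinLocalSplittings`, `GLn.ofFinite`) is written for `Fin n`-indexed
unitary groups.  This file supplies the bridge along an enumeration `e : Fin N × Fin M ≃ Fin n`:

* §1 (any commutative ring) `dualPairReindex σ e HV HW : U(σ,H_V) × U(σ,H_W) →* U(σ, reindex e e (H_V ⊗ₖ H_W))`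
  (`reindexU ∘ dualPair`), its matrix `reindex e e (g ⊗ₖ g')`; and for a LINE `W` (`m` a singleton, `H_W = (w)` with
  `w` a unit) **the `V`-member is ONTO**: every element of `U(σ, reindex e e (H_V ⊗ₖ (w)))` is `reindex e e (g ⊗ₖ 1)`
  for a unique-up-to-the-obvious `g ∈ U(σ, H_V)` (`dualPairReindex_inl_surjective`; for `U(V) × U(1)`, [Liu2021, App. D
  §D.1]: `U(V_e) = U(V)`);
* §2 (number fields `E/F`, `c`) the big form `J_{VW} := reindex e e (J_V ⊗ₖ J_W) ∈ M_n(E)` has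
  `finiteAdelicForm / adelicForm (J_{VW}) = reindex e e (… J_V ⊗ₖ … J_W)` (`finiteAdelicForm_reindex_kronecker`,
  `adelicForm_reindex_kronecker`); the **finite-adelic pair embedding**
  `finPairEmb : U(J_V)(𝔸_{F,f}) × U(J_W)(𝔸_{F,f}) →* U(J_{VW})(𝔸_{F,f})` and the adelic one
  `adelicPairEmb : G₁(𝔸_F) = adelicPair →* U(J_{VW})(𝔸_F)`, with
  **`finAdelicToAdelic (finPairEmb (k, u)) = adelicPairEmb (a(1,k) · b(1,u))`** (`finAdelicToAdelic_finPairEmb`: the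
  matrix identity `(1, reindex (k ⊗ u)) = reindex ((1,k) ⊗ (1,u))` in `GL_n(𝔸_E)`), and the action on
  `Res_{E/F}`-coordinates: `resAut (adelicPairEmb g) = W_e ∘ resAut g ∘ W_e⁻¹` (`resAut_adelicPairEmb`, from the tree's
  `resAut_reindexGL`), so that `U(J_{VW})(𝔸_F) → Sp` and `G₁(𝔸_F) → Sp` (`adelicToSymplectic`, `adelicPairToSymplectic`)
  agree up to `spReindex e` on these elements (`coe_adelicToSymplectic_adelicPairEmb`).

Written for the Hodge/COR-CM transposition lane (item (vi)): the reference section of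
`GelbartRogawski1991/UnitaryDualPairWeilCoinvariantsReference.lean` assembled from LOCAL splittings of the big group
needs exactly this embedding and these two compatibilities.

## References
* [GelbartRogawski1991] S. Gelbart, J. Rogawski, Invent. Math. 105 (1991), §3.1 p. 454, §3.2 p. 457.
* [MoeglinVignerasWaldspurger1987] C. Mœglin, M.-F. Vignéras, J.-L. Waldspurger, LNM 1291, Chap. 1 I.17 (dual pairs).
* [Liu2021] Y. Liu, Camb. J. Math. 9 (2021) = arXiv:2102.11518, App. D §D.1 Steps 1–2 (l. 5214–5219).
-/

set_option autoImplicit false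

noncomputable section

open scoped Matrix Kronecker
open NumberField IsDedekindDomain

namespace Literature.NumberTheory.Automorphic

namespace UnitaryGroup

/-! ## §1 The dual pair in an enumeration, over any commutative ring -/

section Generic

variable {S : Type*} [CommRing S] {n m n' : Type*} [Fintype n] [DecidableEq n] [Fintype m] [DecidableEq m]
  [Fintype n'] [DecidableEq n'] (σ : S →+* S) (e : n × m ≃ n') (HV : Matrix n n S) (HW : Matrix m m S)

/-- **`U(σ,H_V) × U(σ,H_W) →* U(σ, reindex e e (H_V ⊗ₖ H_W))`**, `(g, g') ↦ reindex e e (g ⊗ₖ g')`: the dual pair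
read in the enumeration `e` of `V ⊗ W`. [cite: GelbartRogawski1991, §3.2 p. 457] -/
def dualPairReindex :
    unitaryGroupOfForm σ HV × unitaryGroupOfForm σ HW →* unitaryGroupOfForm σ (Matrix.reindex e e (HV ⊗ₖ HW)) :=
  (reindexU σ e (HV ⊗ₖ HW)).comp (dualPair σ HV HW)

/-- underlying invertible matrix: `reindexGL e (kroneckerGL (g, g'))`. [cite: GelbartRogawski1991, §3.2 p. 457] -/
@[simp] theorem coe_dualPairReindex (gg : unitaryGroupOfForm σ HV × unitaryGroupOfForm σ HW) :
    ((dualPairReindex σ e HV HW gg : unitaryGroupOfForm σ (Matrix.reindex e e (HV ⊗ₖ HW))) : GL n' S) =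
      reindexGL e (kroneckerGL ((gg.1 : GL n S), (gg.2 : GL m S))) := rfl

/-- underlying matrix: `reindex e e (g ⊗ₖ g')`. [cite: GelbartRogawski1991, §3.2 p. 457] -/
theorem coe_coe_dualPairReindex (gg : unitaryGroupOfForm σ HV × unitaryGroupOfForm σ HW) :
    (((dualPairReindex σ e HV HW gg : unitaryGroupOfForm σ (Matrix.reindex e e (HV ⊗ₖ HW))) : GL n' S) :
        Matrix n' n' S) =
      Matrix.reindex e e (((gg.1 : GL n S) : Matrix n n S) ⊗ₖ ((gg.2 : GL m S) : Matrix m m S)) := rfl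

/-- the two members commute («`a(g)` and `b(g')` commute»). [cite: MoeglinVignerasWaldspurger1987, Chap. 1 I.17] -/
theorem commute_dualPairReindex_inl_inr (g : unitaryGroupOfForm σ HV) (g' : unitaryGroupOfForm σ HW) :
    Commute (dualPairReindex σ e HV HW (g, 1)) (dualPairReindex σ e HV HW (1, g')) := by
  rw [Commute, SemiconjBy, ← map_mul, ← map_mul, Prod.mk_mul_mk, Prod.mk_mul_mk, one_mul, mul_one, one_mul, mul_one]

/-- **For a LINE `W` the `V`-member is onto.**  If `m` is a singleton and the `1 × 1` Gram matrix `H_W = (w)` has `w` a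
unit, every `G ∈ U(σ, reindex e e (H_V ⊗ₖ H_W))` is `reindex e e (g ⊗ₖ 1)` for some `g ∈ U(σ, H_V)` — i.e.
`U(V ⊗ W) = U(V)` for a hermitian line `W` ([Liu2021, App. D §D.1]: the oscillator representation of `Mp(V_ε)` is
restricted to `U(V)`, the symplectic space being `Res V` with the form scaled by the line). [cite: Liu2021, App. D §D.1 Steps 1–2 (l. 5214–5219)] -/
theorem dualPairReindex_inl_surjective [Unique m] (hw : IsUnit (HW default default))
    (G : unitaryGroupOfForm σ (Matrix.reindex e e (HV ⊗ₖ HW))) :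
    ∃ g : unitaryGroupOfForm σ HV, dualPairReindex σ e HV HW (g, 1) = G := by
  -- the candidate: `g := reindex (e⁻¹, then n × m ≃ n) G`
  let e₀ : n' ≃ n := e.symm.trans (Equiv.prodUnique n m)
  let g : GL n S := reindexGL e₀ (G : GL n' S)
  have hg_entry : ∀ i j : n, (g : Matrix n n S) i j = ((G : GL n' S) : Matrix n' n' S) (e (i, default)) (e (j, default)) :=
    fun i j => rfl
  -- `reindex e e (g ⊗ₖ 1) = G`
  have hG : reindexGL e (kroneckerGL (g, (1 : GL m S))) = (G : GL n' S) := by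
    refine Units.ext (Matrix.ext fun a b => ?_)
    obtain ⟨⟨i, k⟩, rfl⟩ := e.surjective a
    obtain ⟨⟨j, k'⟩, rfl⟩ := e.surjective b
    obtain rfl : k = default := Unique.eq_default k
    obtain rfl : k' = default := Unique.eq_default k'
    rw [coe_reindexGL, Matrix.reindex_apply, Matrix.submatrix_apply, Equiv.symm_apply_apply, Equiv.symm_apply_apply,
      coe_kroneckerGL, Matrix.kroneckerMap_apply, Units.val_one, Matrix.one_apply_eq, mul_one, hg_entry]
  -- `g` is unitary for `H_V`: read the unitarity of `G` at the entries `(e(i,⋆), e(j,⋆))` and cancel the unit `w`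
  have hmem : g ∈ unitaryGroupOfForm σ HV := by
    have hG' : kroneckerGL (g, (1 : GL m S)) ∈ unitaryGroupOfForm σ (HV ⊗ₖ HW) := by
      rw [← reindexGL_mem_iff σ e, hG]
      exact G.2
    rw [mem_unitaryGroupOfForm_iff] at hG' ⊢
    rw [coe_kroneckerGL, Units.val_one, kronecker_map, kronecker_transpose, ← Matrix.mul_kronecker_mul,
      ← Matrix.mul_kronecker_mul, Matrix.map_one σ (map_zero σ) (map_one σ), Matrix.transpose_one, Matrix.one_mul,
      Matrix.mul_one] at hG'
    ext i j
    have h1 := congrFun (congrFun hG' (i, default)) (j, default)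
    simp only [Matrix.kroneckerMap_apply] at h1
    exact hw.mul_left_injective h1
  refine ⟨⟨g, hmem⟩, Subtype.ext ?_⟩
  rw [coe_dualPairReindex]
  exact hG

end Generic

/-! ## §2 Number fields: the finite-adelic and adelic pair embeddings into `U(reindex e e (J_V ⊗ₖ J_W))` -/

section Adelic

variable (F E : Type) [Field F] [NumberField F] [Field E] [NumberField E] [Algebra F E]
variable (c : E ≃ₐ[F] E) (N M : ℕ) {n : ℕ} (e : Fin N × Fin M ≃ Fin n)
variable (JV : Matrix (Fin N) (Fin N) E) (JW : Matrix (Fin M) (Fin M) E)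

omit [NumberField F] in
/-- `finiteAdelicForm (reindex e e (J_V ⊗ₖ J_W)) = reindex e e (finiteAdelicForm J_V ⊗ₖ finiteAdelicForm J_W)` (the Gram
matrix of `V ⊗ W` over `𝔸_E^∞`). [cite: GelbartRogawski1991, §3.1 p. 454] -/
theorem finiteAdelicForm_reindex_kronecker :
    finiteAdelicForm E n (Matrix.reindex e e (JV ⊗ₖ JW)) =
      Matrix.reindex e e (finiteAdelicForm E N JV ⊗ₖ finiteAdelicForm E M JW) := by
  rw [finiteAdelicForm, finiteAdelicForm, finiteAdelicForm, kronecker_map_map]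
  rfl

omit [NumberField F] in
/-- `adelicForm (reindex e e (J_V ⊗ₖ J_W)) = reindex e e (adelicForm J_V ⊗ₖ adelicForm J_W)` (the Gram matrix of `V ⊗ W`
over `𝔸_E`). [cite: GelbartRogawski1991, §3.1 p. 454] -/
theorem adelicForm_reindex_kronecker :
    adelicForm E n (Matrix.reindex e e (JV ⊗ₖ JW)) = Matrix.reindex e e (adelicForm E N JV ⊗ₖ adelicForm E M JW) := by
  rw [adelicForm, adelicForm, adelicForm, kronecker_map_map]
  rfl

omit [NumberField F] in
/-- `reindex e e (k ⊗ₖ u) ∈ U(J_{VW})(𝔸_{F,f})` for `k ∈ U(J_V)(𝔸_{F,f})`, `u ∈ U(J_W)(𝔸_{F,f})`.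
[cite: MoeglinVignerasWaldspurger1987, Chap. 1 I.17] -/
theorem reindexGL_kroneckerGL_mem_finAdelic (k : finAdelic F E c N JV) (u : finAdelic F E c M JW) :
    reindexGL e (kroneckerGL ((k : GL (Fin N) (FiniteAdeleRing (𝓞 E) E)), (u : GL (Fin M) (FiniteAdeleRing (𝓞 E) E)))) ∈
      finAdelic F E c n (Matrix.reindex e e (JV ⊗ₖ JW)) := by
  have h := kroneckerGL_mem_unitaryGroupOfForm (conjFiniteAdele F E c) k.2 u.2
  rw [← reindexGL_mem_iff (conjFiniteAdele F E c) e, ← finiteAdelicForm_reindex_kronecker] at h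
  exact h

/-- **The finite-adelic pair embedding `U(J_V)(𝔸_{F,f}) × U(J_W)(𝔸_{F,f}) →* U(J_{VW})(𝔸_{F,f})`**,
`J_{VW} = reindex e e (J_V ⊗ₖ J_W)`, `(k, u) ↦ reindex e e (k ⊗ₖ u)`. [cite: GelbartRogawski1991, §3.2 p. 457] -/
def finPairEmb : finAdelic F E c N JV × finAdelic F E c M JW →* finAdelic F E c n (Matrix.reindex e e (JV ⊗ₖ JW)) :=
  ((reindexGL e).comp (kroneckerGL.comp
    ((finAdelic F E c N JV).subtype.prodMap (finAdelic F E c M JW).subtype))).codRestrict _ fun p =>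
      reindexGL_kroneckerGL_mem_finAdelic F E c N M e JV JW p.1 p.2

omit [NumberField F] in
/-- underlying invertible matrix of `finPairEmb (k, u)`: `reindexGL e (kroneckerGL (k, u))`. [cite: GelbartRogawski1991, §3.2 p. 457] -/
@[simp] theorem coe_finPairEmb (p : finAdelic F E c N JV × finAdelic F E c M JW) :
    ((finPairEmb F E c N M e JV JW p : finAdelic F E c n (Matrix.reindex e e (JV ⊗ₖ JW))) :
        GL (Fin n) (FiniteAdeleRing (𝓞 E) E)) =
      reindexGL e (kroneckerGL ((p.1 : GL (Fin N) (FiniteAdeleRing (𝓞 E) E)), (p.2 : GL (Fin M) _))) := rfl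

omit [NumberField F] in
/-- the two members of `finPairEmb` commute. [cite: MoeglinVignerasWaldspurger1987, Chap. 1 I.17] -/
theorem commute_finPairEmb_inl_inr (k : finAdelic F E c N JV) (u : finAdelic F E c M JW) :
    Commute (finPairEmb F E c N M e JV JW (k, 1)) (finPairEmb F E c N M e JV JW (1, u)) := by
  change _ * _ = _ * _
  rw [← map_mul, ← map_mul, Prod.mk_mul_mk, Prod.mk_mul_mk, one_mul, mul_one, one_mul, mul_one]

omit [NumberField F] in
/-- `reindex e e g ∈ U(J_{VW})(𝔸_F)` for `g ∈ G₁(𝔸_F) = U(J_V ⊗ J_W)(𝔸_F)`. [cite: GelbartRogawski1991, §3.2 p. 457] -/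
theorem reindexGL_mem_adelic (g : adelicPair F E c N M JV JW) :
    reindexGL e (g : GL (Fin N × Fin M) (AdeleRing (𝓞 E) E)) ∈ adelic F E c n (Matrix.reindex e e (JV ⊗ₖ JW)) := by
  have h : (g : GL (Fin N × Fin M) (AdeleRing (𝓞 E) E)) ∈
      unitaryGroupOfForm (conjAdele F E c) (adelicForm E N JV ⊗ₖ adelicForm E M JW) := g.2
  rw [← reindexGL_mem_iff (conjAdele F E c) e, ← adelicForm_reindex_kronecker] at h
  exact h

/-- **The adelic pair embedding `G₁(𝔸_F) = U(J_V ⊗ J_W)(𝔸_F) →* U(J_{VW})(𝔸_F)`**, `g ↦ reindex e e g`.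
[cite: GelbartRogawski1991, §3.2 p. 457] -/
def adelicPairEmb : adelicPair F E c N M JV JW →* adelic F E c n (Matrix.reindex e e (JV ⊗ₖ JW)) :=
  ((reindexGL e).comp (adelicPair F E c N M JV JW).subtype).codRestrict _ fun g =>
    reindexGL_mem_adelic F E c N M e JV JW g

omit [NumberField F] in
/-- underlying invertible matrix of `adelicPairEmb g`: `reindexGL e g`. [cite: GelbartRogawski1991, §3.2 p. 457] -/
@[simp] theorem coe_adelicPairEmb (g : adelicPair F E c N M JV JW) :
    ((adelicPairEmb F E c N M e JV JW g : adelic F E c n (Matrix.reindex e e (JV ⊗ₖ JW))) :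
        GL (Fin n) (AdeleRing (𝓞 E) E)) = reindexGL e (g : GL (Fin N × Fin M) _) := rfl

omit [NumberField F] in
/-- **`(1, reindex (k ⊗ u)) = reindex ((1, k) ⊗ (1, u))` in `GL_n(𝔸_E)`** (the finite-adelic dual pair inside the
adelic one). [cite: GelbartRogawski1991, §3.2 p. 457] -/
theorem ofFinite_reindexGL_kroneckerGL (k : GL (Fin N) (FiniteAdeleRing (𝓞 E) E))
    (u : GL (Fin M) (FiniteAdeleRing (𝓞 E) E)) :
    GLn.ofFinite n E (reindexGL e (kroneckerGL (k, u))) =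
      reindexGL e (kroneckerGL (GLn.ofFinite N E k, GLn.ofFinite M E u)) := by
  refine Units.ext (Matrix.ext fun a b => ?_)
  obtain ⟨⟨i, i'⟩, rfl⟩ := e.surjective a
  obtain ⟨⟨j, j'⟩, rfl⟩ := e.surjective b
  rw [GLn.coe_ofFinite_apply]
  simp only [coe_reindexGL, Matrix.reindex_apply, Matrix.submatrix_apply, Equiv.symm_apply_apply, coe_kroneckerGL,
    Matrix.kroneckerMap_apply, GLn.coe_ofFinite_apply]
  refine Prod.ext ?_ rfl
  -- `(1 : M_n)_{e(i,i'), e(j,j')} = 1_{ij} · 1_{i'j'}`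
  change (1 : Matrix (Fin n) (Fin n) (InfiniteAdeleRing E)) (e (i, i')) (e (j, j')) =
    (1 : Matrix (Fin N) (Fin N) (InfiniteAdeleRing E)) i j * (1 : Matrix (Fin M) (Fin M) (InfiniteAdeleRing E)) i' j'
  simp only [Matrix.one_apply, EmbeddingLike.apply_eq_iff_eq, Prod.mk.injEq]
  by_cases hi : i = j <;> by_cases hi' : i' = j' <;> simp [hi, hi']

/-- **The finite-adelic pair embedding followed by `g ↦ (1, g)` is the adelic pair embedding of `a(1,k) · b(1,u)`.**
[cite: GelbartRogawski1991, §3.2 p. 457] -/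
theorem finAdelicToAdelic_finPairEmb (k : finAdelic F E c N JV) (u : finAdelic F E c M JW) :
    finAdelicToAdelic F E c n (Matrix.reindex e e (JV ⊗ₖ JW)) (finPairEmb F E c N M e JV JW (k, u)) =
      adelicPairEmb F E c N M e JV JW
        (dualPair (conjAdele F E c) (adelicForm E N JV) (adelicForm E M JW)
          ((finAdelicToAdelic F E c N JV k : adelic F E c N JV), (finAdelicToAdelic F E c M JW u : adelic F E c M JW))) := by
  refine Subtype.ext ?_
  change GLn.ofFinite n E (reindexGL e (kroneckerGL ((k : GL (Fin N) (FiniteAdeleRing (𝓞 E) E)),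
      (u : GL (Fin M) (FiniteAdeleRing (𝓞 E) E))))) =
    reindexGL e (kroneckerGL (GLn.ofFinite N E (k : GL (Fin N) (FiniteAdeleRing (𝓞 E) E)),
      GLn.ofFinite M E (u : GL (Fin M) (FiniteAdeleRing (𝓞 E) E))))
  exact ofFinite_reindexGL_kroneckerGL E N M e _ _

omit [NumberField F] in
/-- **For a hermitian LINE `W = ⟨a⟩` (`M = 1`, `J_W = (a)`, `a ≠ 0`) the `V`-member of `finPairEmb` is ONTO**: every
`G ∈ U(J_{VW})(𝔸_{F,f})` is `reindex e e (k ⊗ₖ 1)` for some `k ∈ U(J_V)(𝔸_{F,f})` — `U(V ⊗ ⟨a⟩) = U(V)`.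
[cite: Liu2021, App. D §D.1 Steps 1–2 (l. 5214–5219)] -/
theorem finPairEmb_inl_surjective_of_line (e : Fin N × Fin 1 ≃ Fin n) (JW : Matrix (Fin 1) (Fin 1) E)
    (hJW : JW 0 0 ≠ 0) (G : finAdelic F E c n (Matrix.reindex e e (JV ⊗ₖ JW))) :
    ∃ k : finAdelic F E c N JV, finPairEmb F E c N 1 e JV JW (k, 1) = G := by
  have h0 : finiteAdelicForm E 1 JW default default = algebraMap E (FiniteAdeleRing (𝓞 E) E) (JW 0 0) := rfl
  have hw : IsUnit (finiteAdelicForm E 1 JW default default) := by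
    rw [h0]
    exact (isUnit_iff_ne_zero.2 hJW).map _
  have hG : (G : GL (Fin n) (FiniteAdeleRing (𝓞 E) E)) ∈
      unitaryGroupOfForm (conjFiniteAdele F E c) (Matrix.reindex e e (finiteAdelicForm E N JV ⊗ₖ finiteAdelicForm E 1 JW)) := by
    rw [← finiteAdelicForm_reindex_kronecker]
    exact G.2
  obtain ⟨g, hg⟩ := dualPairReindex_inl_surjective (conjFiniteAdele F E c) e (finiteAdelicForm E N JV)
    (finiteAdelicForm E 1 JW) hw ⟨_, hG⟩
  have hg' := congrArg (fun x : unitaryGroupOfForm (conjFiniteAdele F E c)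
    (Matrix.reindex e e (finiteAdelicForm E N JV ⊗ₖ finiteAdelicForm E 1 JW)) => (x : GL (Fin n) (FiniteAdeleRing (𝓞 E) E))) hg
  dsimp only at hg'
  rw [coe_dualPairReindex] at hg'
  refine ⟨g, Subtype.ext ?_⟩
  rw [coe_finPairEmb]
  exact hg'

variable [Algebra.IsQuadraticExtension F E] {δ : E} (hcδ : c δ = -δ) (hδ : δ ≠ 0) {d : F}
  (hd : δ * δ = algebraMap F E d)

/-- **`Res_{E/F}`-coordinates of the embedded element**: `resAut (reindex g) = W_e ∘ resAut g ∘ W_e⁻¹` on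
`𝔸_F^n × 𝔸_F^n` (the tree's `resAut_reindexGL`). [cite: GelbartRogawski1991, §3.1 p. 454] -/
theorem resAut_adelicPairEmb (g : adelicPair F E c N M JV JW) :
    (isQuadraticCoordinates_adele E c hcδ hδ hd).resAut (Fin n)
        ((adelicPairEmb F E c N M e JV JW g : adelic F E c n (Matrix.reindex e e (JV ⊗ₖ JW))) :
          GL (Fin n) (AdeleRing (𝓞 E) E)) =
      ((reindexW (AdeleRing (𝓞 F) F) e).symm.trans
        ((isQuadraticCoordinates_adele E c hcδ hδ hd).resAut (Fin N × Fin M) (g : GL (Fin N × Fin M) _))).trans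
        (reindexW (AdeleRing (𝓞 F) F) e) := by
  rw [coe_adelicPairEmb]
  exact (isQuadraticCoordinates_adele E c hcδ hδ hd).resAut_reindexGL e _

variable {TV : Matrix (Fin N) (Fin N) F} {TW : Matrix (Fin M) (Fin M) F} (hV : TV.IsSymm) (hW : TW.IsSymm)
  (hJV : JV = TV.map (algebraMap F E)) (hJW : JW = TW.map (algebraMap F E))
  {T' : Matrix (Fin n) (Fin n) F} (hT' : T'.IsSymm) (hJ' : Matrix.reindex e e (JV ⊗ₖ JW) = T'.map (algebraMap F E))

/-- **`U(J_{VW})(𝔸_F) → Sp` and `G₁(𝔸_F) → Sp` agree on embedded elements up to `spReindex e`**, as automorphisms of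
`𝔸_F^n × 𝔸_F^n`: `adelicToSymplectic (adelicPairEmb g) = W_e ∘ adelicPairToSymplectic g ∘ W_e⁻¹` (for ANY
`F`-rational symmetric Gram matrix `T'` of the big form — the coordinates do not see `T'`). [cite: GelbartRogawski1991, §3.1 p. 454] -/
theorem coe_adelicToSymplectic_adelicPairEmb (g : adelicPair F E c N M JV JW) :
    ((adelicToSymplectic F E c n hcδ hδ hd hT' hJ' (adelicPairEmb F E c N M e JV JW g)).1 :
        ((Fin n → AdeleRing (𝓞 F) F) × (Fin n → AdeleRing (𝓞 F) F)) ≃ₗ[AdeleRing (𝓞 F) F]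
          ((Fin n → AdeleRing (𝓞 F) F) × (Fin n → AdeleRing (𝓞 F) F))) =
      ((reindexW (AdeleRing (𝓞 F) F) e).symm.trans
        (adelicPairToSymplectic F E c N M hcδ hδ hd hV hW hJV hJW g).1).trans (reindexW (AdeleRing (𝓞 F) F) e) := by
  have h1 : ((adelicToSymplectic F E c n hcδ hδ hd hT' hJ' (adelicPairEmb F E c N M e JV JW g)).1 :
      ((Fin n → AdeleRing (𝓞 F) F) × (Fin n → AdeleRing (𝓞 F) F)) ≃ₗ[AdeleRing (𝓞 F) F]
        ((Fin n → AdeleRing (𝓞 F) F) × (Fin n → AdeleRing (𝓞 F) F))) =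
      (isQuadraticCoordinates_adele E c hcδ hδ hd).resAut (Fin n)
        ((adelicPairEmb F E c N M e JV JW g : adelic F E c n (Matrix.reindex e e (JV ⊗ₖ JW))) :
          GL (Fin n) (AdeleRing (𝓞 E) E)) := rfl
  rw [h1, resAut_adelicPairEmb F E c N M e JV JW hcδ hδ hd g]
  rfl

end Adelic

end UnitaryGroup

end Literature.NumberTheory.Automorphic

end
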